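import Summits.CriticalPhenomena.PercolationContinuityZ3.Theorems.PercNearOneGluingNoHeavyLowerTailThreePartitionGridMatching
import Summits.CriticalPhenomena.PercolationContinuityZ3.Theorems.PercNearOneGluingNoHeavyLowerTailThreePartitionGridFibrePairing
import Summits.CriticalPhenomena.PercolationContinuityZ3.Theorems.PercNearOneGluingNoHeavyLowerTailThreePartitionGridHall
import Summits.CriticalPhenomena.PercolationContinuityZ3.Theorems.PercNearOneGluingNoHeavyLowerTailThreePartitionGridBalanced
import HarnessLib.Audit

/-!
# `NoHeavyLowerTail` (crux stmt-CriticalPhenomena-4575), master-family hierarchy P3 (gen 35): the typed fibre-local token matching EXISTS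
# for every nested pair `𝒱 ⊆ 𝒲` and every twist — the Kleitman block of the `N3` tokens inside an x₃-fibre

Support file (seat `prim-masterthm-p3`; `--supports stmt-CriticalPhenomena-4575`; memo
`run/shared/lean/prim/prim-masterthm/FROM-prim-masterthm-p3-g34-FIBRE-LOCAL-CERTIFICATE.md` §8, HIERARCHY §41).  Companion of
`…ThreePartitionGridTop` (`𝒱 = ⊤`, hence the terminal representative of `𝒲 ⊆ 𝒱`) and `…ThreePartitionGridBalanced` (`#a-sites ≤ #bad`), same toolkit
(`…ThreePartitionGridFibrePairing`).
THE CLASS.  `𝒱 ⊆ 𝒲`: there are NO bad tokens (`x₁ ∈ 𝒱∖𝒲` is empty), so nothing moves between cube fibres.  After the pointwise cancellations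
(`N1 = {x₁∈𝒱, x₃∈𝒲}` sits at a `P`-configuration and takes its own unit `a`; `N2` with `x₁ ∈ 𝒱` takes its own unit `b`; `N3` with `x₃ ∈ 𝒲`
takes its own `T₂` token) two fibre-local blocks remain, both inside x₃-fibres (first two PARTS have union `U`; copy 1 runs over the folding
fibre `(U, τ∖U)`, copy 2 is its reflection `x₂ = x₁ ∆ U`):
* the `N3` tokens `{x₂ ∈ 𝒱, x₃ ∉ 𝒲}` go to unit `a` of `{x₁ ∈ 𝒱, x₃ ∉ 𝒲}` (free, since their own `N1` would need `x₃ ∈ 𝒲`): a token with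
  `x₁ ∈ 𝒱` takes its own unit `a`, and the others — the points `σ𝒱∖𝒱` of the fibre — are matched BIJECTIVELY and increasingly onto
  `𝒱∖σ𝒱` (the configurations `{x₁ ∈ 𝒱, x₂ ∉ 𝒱}`, which carry no `N3` token) by the strict Kleitman pairing `exists_fibre_pairing` for `𝒱`;
  this is the **Kleitman block** `σ𝒜 → 𝒜` of the rescue normal form (memo §8d (i) with no rescued sites), in the kernel for the first time;
* the `N2` tokens off `P` (`x₁ ∈ 𝒲∖𝒱, x₂ ∈ 𝒱`) go to the free units `b` (`x₁ ∈ 𝒱, x₂ ∉ 𝒱`) by `exists_fibre_injection` (Harris), exactly as in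
  `…ThreePartitionGridBalanced`.
**`typedMatchable_of_subset`**.  With `typedMatchable_univ` both extreme nested classes of the conjecture `TypedGridMatching` are in the kernel
(`GridTransport` for all nested pairs was already known at the level of sums, `…ThreePartitionGridNested`; this is the TYPED structure).
HONEST LABEL: one more class of an open conjecture (`TypedGridMatching` ⟹ `GridTransport` ⟹ COMB-C3 ⟹ Sahi's `C₃`); the general case (bad tokens
choosing between a-landings and b-diversions, memo §8d) is OPEN; nothing here bears on the crux. [this work]
-/

noncomputable section

open Finset
open scoped symmDiff Classical

namespace Summit.CriticalPhenomena.PercolationContinuityZ3.Theorems.ThreePartition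

variable {ι : Type*} [Fintype ι]

/-- **The typed matching for nested pairs `𝒱 ⊆ 𝒲`** (all twists): pointwise cancellations, the Kleitman block `σ𝒱 → 𝒱` for the `N3` tokens
inside each x₃-fibre off `𝒲` (`exists_fibre_pairing` for `𝒱` on the folding fibre `(S₁∪S₂, τ∖(S₁∪S₂))`), and the Harris injection of the `N2`
tokens off `P` into the free units `b` (`exists_fibre_injection`). [this work] -/
theorem typedMatchable_of_subset (τ : Set ι) {𝒱 𝒲 : Set (Set ι)} (h𝒱 : IsUpperSet 𝒱) (h𝒲 : IsUpperSet 𝒲) (hVW : 𝒱 ⊆ 𝒲) :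
    TypedMatchable τ 𝒱 𝒲 := by
  -- one strict Kleitman pairing for `𝒱` per x₃-fibre `(U, τ \ U)`, and one Harris injection for `(𝒲, 𝒱)`
  have hK := fun U : Set ι => exists_fibre_pairing h𝒱 U (τ \ U)
  choose g hg using hK
  have hH := fun U : Set ι => exists_fibre_injection h𝒲 h𝒱 U (τ \ U)
  choose h hh using hH
  -- the configuration of the x₃-fibre with first two parts of union `U` whose copy 1 is the point `b`
  let mk : Set ι → Set ι → Set ι × Set ι := fun U b => ((b ∆ τ) ∩ U, U \ ((b ∆ τ) ∩ U))
  have hmk : ∀ U b : Set ι, b \ U = τ \ U →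
      Disjoint (mk U b).1 (mk U b).2 ∧ (mk U b).1 ∪ (mk U b).2 = U ∧ cp₁ τ (mk U b) = b ∧ cp₂ τ (mk U b) = b ∆ U := by
    intro U b hb
    have hdis : Disjoint (mk U b).1 (mk U b).2 := Set.disjoint_sdiff_right
    have hun : (mk U b).1 ∪ (mk U b).2 = U := mk₃_union τ U b
    have hc1 : cp₁ τ (mk U b) = b := symmDiff_inter_symmDiff_of_fibre τ hb
    refine ⟨hdis, hun, hc1, ?_⟩
    rw [cp₂_eq_cp₁_symmDiff_union τ hdis, hun, hc1]
  -- (ii) the Kleitman move of an `N3` token off `T₂` whose copy 1 is not in `𝒱`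
  let Kc : Set ι × Set ι → Set ι × Set ι := fun q => mk (q.1 ∪ q.2) (g (q.1 ∪ q.2) (cp₁ τ q))
  have memBad : ∀ q : Set ι × Set ι, Disjoint q.1 q.2 → cp₁ τ q ∉ 𝒱 → cp₂ τ q ∈ 𝒱 →
      cp₁ τ q ∈ (↑(univ.filter fun a : Set ι => a \ (q.1 ∪ q.2) = τ \ (q.1 ∪ q.2) ∧ a ∉ 𝒱 ∧ a ∆ (q.1 ∪ q.2) ∈ 𝒱) : Set (Set ι)) := by
    intro q hd h1v h2v
    rw [mem_coe, mem_filter]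
    exact ⟨mem_univ _, cp₁_sdiff_union τ q, h1v, by rw [← cp₂_eq_cp₁_symmDiff_union τ hd]; exact h2v⟩
  have hKc : ∀ q : Set ι × Set ι, Disjoint q.1 q.2 → cp₁ τ q ∉ 𝒱 → cp₂ τ q ∈ 𝒱 →
      Disjoint (Kc q).1 (Kc q).2 ∧ (Kc q).1 ∪ (Kc q).2 = q.1 ∪ q.2 ∧ cp₁ τ (Kc q) = g (q.1 ∪ q.2) (cp₁ τ q) ∧
      cp₁ τ (Kc q) ∈ 𝒱 ∧ cp₂ τ (Kc q) ∉ 𝒱 ∧ cp₃ τ (Kc q) = cp₃ τ q ∧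
      cp₁ τ q ⊆ cp₁ τ (Kc q) ∧ cp₂ τ (Kc q) ⊆ cp₂ τ q := by
    intro q hd h1v h2v
    have ha2 : cp₁ τ q ∆ (q.1 ∪ q.2) ∈ 𝒱 := by rwa [← cp₂_eq_cp₁_symmDiff_union τ hd]
    have hb := (hg (q.1 ∪ q.2)).1.mapsTo (memBad q hd h1v h2v)
    rw [mem_coe, mem_filter] at hb
    obtain ⟨-, hb0, hbv, hb2⟩ := hb
    have hab : cp₁ τ q ⊆ g (q.1 ∪ q.2) (cp₁ τ q) := (hg (q.1 ∪ q.2)).2 _ (cp₁_sdiff_union τ q) h1v ha2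
    obtain ⟨hdis, hun, hc1, hc2⟩ := hmk (q.1 ∪ q.2) _ hb0
    have hc3 : cp₃ τ (Kc q) = cp₃ τ q := by
      show ((Kc q).1 ∪ (Kc q).2)ᶜ ∆ τ = (q.1 ∪ q.2)ᶜ ∆ τ
      rw [hun]
    refine ⟨hdis, hun, hc1, by rw [hc1]; exact hbv, by rw [hc2]; exact hb2, hc3, by rw [hc1]; exact hab, ?_⟩
    rw [hc2, cp₂_eq_cp₁_symmDiff_union τ hd]
    exact symmDiff_subset_symmDiff_of_fibre (cp₁_sdiff_union τ q) hb0 hab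
  -- (iii) the move of the `N2` tokens off `P`
  let Cc : Set ι × Set ι → Set ι × Set ι := fun q => mk (q.1 ∪ q.2) (h (q.1 ∪ q.2) (cp₁ τ q))
  have hCc : ∀ q : Set ι × Set ι, Disjoint q.1 q.2 → cp₁ τ q ∈ 𝒲 → cp₁ τ q ∉ 𝒱 → cp₂ τ q ∈ 𝒱 →
      Disjoint (Cc q).1 (Cc q).2 ∧ (Cc q).1 ∪ (Cc q).2 = q.1 ∪ q.2 ∧ cp₁ τ (Cc q) = h (q.1 ∪ q.2) (cp₁ τ q) ∧
      cp₁ τ (Cc q) ∈ 𝒱 ∧ cp₁ τ (Cc q) ∈ 𝒲 ∧ cp₂ τ (Cc q) ∉ 𝒱 ∧ cp₃ τ (Cc q) = cp₃ τ q ∧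
      cp₁ τ q ⊆ cp₁ τ (Cc q) ∧ cp₂ τ (Cc q) ⊆ cp₂ τ q := by
    intro q hd h1w h1v h2v
    have ha2 : cp₁ τ q ∆ (q.1 ∪ q.2) ∈ 𝒱 := by rwa [← cp₂_eq_cp₁_symmDiff_union τ hd]
    obtain ⟨⟨hb0, hbw, hbv, hb2⟩, hab⟩ := (hh (q.1 ∪ q.2)).2 _ (cp₁_sdiff_union τ q) h1w h1v ha2
    obtain ⟨hdis, hun, hc1, hc2⟩ := hmk (q.1 ∪ q.2) _ hb0
    have hc3 : cp₃ τ (Cc q) = cp₃ τ q := by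
      show ((Cc q).1 ∪ (Cc q).2)ᶜ ∆ τ = (q.1 ∪ q.2)ᶜ ∆ τ
      rw [hun]
    refine ⟨hdis, hun, hc1, by rw [hc1]; exact hbv, by rw [hc1]; exact hbw, by rw [hc2]; exact hb2, hc3, by rw [hc1]; exact hab, ?_⟩
    rw [hc2, cp₂_eq_cp₁_symmDiff_union τ hd]
    exact symmDiff_subset_symmDiff_of_fibre (cp₁_sdiff_union τ q) hb0 hab
  -- the matching
  let Φ : (Set ι × Set ι) × Fin 3 → (Set ι × Set ι) × Fin 3 := fun t =>
    if t.2 = 0 then t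
    else if t.2 = 1 then (if cp₁ τ t.1 ∈ 𝒱 then t else (Cc t.1, 1))
    else (if cp₃ τ t.1 ∈ 𝒲 then t else (if cp₁ τ t.1 ∈ 𝒱 then (t.1, 0) else (Kc t.1, 0)))
  have Φ0 : ∀ q, Φ (q, 0) = (q, 0) := fun q => by simp only [Φ, if_true]
  have Φ1 : ∀ q, Φ (q, 1) = if cp₁ τ q ∈ 𝒱 then (q, 1) else (Cc q, 1) := fun q => by
    simp only [Φ, if_true]
    rw [if_neg (show ¬ ((1 : Fin 3) = 0) by decide)]
  have Φ2 : ∀ q, Φ (q, 2) = if cp₃ τ q ∈ 𝒲 then (q, 2) else (if cp₁ τ q ∈ 𝒱 then (q, 0) else (Kc q, 0)) := fun q => by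
    simp only [Φ]
    rw [if_neg (show ¬ ((2 : Fin 3) = 0) by decide), if_neg (show ¬ ((2 : Fin 3) = 1) by decide)]
  have hneg : ∀ q i, (q, i) ∈ negToks τ 𝒱 𝒲 ↔ Disjoint q.1 q.2 ∧ negCond τ 𝒱 𝒲 q i := by
    intro q i; simp only [negToks, cfgs, mem_filter, mem_product, mem_univ, and_true, true_and]
  have hpos : ∀ q j, (q, j) ∈ posToks τ 𝒱 𝒲 ↔ Disjoint q.1 q.2 ∧ posCond τ 𝒱 𝒲 q j := by
    intro q j; simp only [posToks, cfgs, mem_filter, mem_product, mem_univ, and_true, true_and]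
  have nc0 : ∀ q, negCond τ 𝒱 𝒲 q 0 ↔ cp₁ τ q ∈ 𝒱 ∧ cp₃ τ q ∈ 𝒲 := fun q => by simp [negCond]
  have nc1 : ∀ q, negCond τ 𝒱 𝒲 q 1 ↔ cp₁ τ q ∈ 𝒲 ∧ cp₂ τ q ∈ 𝒱 := fun q => by simp [negCond]
  have nc2 : ∀ q, negCond τ 𝒱 𝒲 q 2 ↔ cp₂ τ q ∈ 𝒱 ∧ cp₂ τ q ∈ 𝒲 := fun q => by simp [negCond]
  have pc0 : ∀ q, posCond τ 𝒱 𝒲 q 0 ↔ cp₁ τ q ∈ 𝒱 ∧ cp₁ τ q ∈ 𝒲 := fun q => by simp [posCond]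
  have pc1 : ∀ q, posCond τ 𝒱 𝒲 q 1 ↔ cp₁ τ q ∈ 𝒱 ∧ cp₁ τ q ∈ 𝒲 := fun q => by simp [posCond]
  have pc2 : ∀ q, posCond τ 𝒱 𝒲 q 2 ↔ cp₂ τ q ∈ 𝒱 ∧ cp₃ τ q ∈ 𝒲 := fun q => by simp [posCond]
  refine ⟨Φ, ?_, ?_⟩
  · rintro ⟨q, i⟩ ht
    obtain ⟨hq, hn⟩ := (hneg q i).1 ht
    fin_cases i
    · simp only [Fin.zero_eta, Fin.isValue] at hn ⊢
      obtain ⟨h1v, -⟩ := (nc0 q).1 hn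
      rw [Φ0]
      exact ⟨(hpos q 0).2 ⟨hq, (pc0 q).2 ⟨h1v, hVW h1v⟩⟩, gle_refl τ q, Or.inl ⟨rfl, Or.inl ⟨rfl, rfl⟩⟩⟩
    · simp only [Fin.mk_one, Fin.isValue] at hn ⊢
      obtain ⟨h1w, h2v⟩ := (nc1 q).1 hn
      rw [Φ1]
      by_cases h1 : cp₁ τ q ∈ 𝒱
      · rw [if_pos h1]
        exact ⟨(hpos q 1).2 ⟨hq, (pc1 q).2 ⟨h1, h1w⟩⟩, gle_refl τ q, Or.inr (Or.inl ⟨rfl, rfl, rfl⟩)⟩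
      · rw [if_neg h1]
        obtain ⟨hdis, -, -, hv, hw, -, h3, hsub1, hsub2⟩ := hCc q hq h1w h1 h2v
        exact ⟨(hpos _ 1).2 ⟨hdis, (pc1 _).2 ⟨hv, hw⟩⟩, ⟨hsub1, hsub2⟩, Or.inr (Or.inl ⟨rfl, rfl, h3⟩)⟩
    · simp only [Fin.reduceFinMk, Fin.isValue] at hn ⊢
      obtain ⟨h2v, -⟩ := (nc2 q).1 hn
      rw [Φ2]
      by_cases h3 : cp₃ τ q ∈ 𝒲
      · rw [if_pos h3]
        exact ⟨(hpos q 2).2 ⟨hq, (pc2 q).2 ⟨h2v, h3⟩⟩, gle_refl τ q, Or.inr (Or.inr ⟨rfl, Or.inr ⟨rfl, rfl⟩⟩)⟩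
      · rw [if_neg h3]
        by_cases h1 : cp₁ τ q ∈ 𝒱
        · rw [if_pos h1]
          exact ⟨(hpos q 0).2 ⟨hq, (pc0 q).2 ⟨h1, hVW h1⟩⟩, gle_refl τ q, Or.inr (Or.inr ⟨rfl, Or.inl ⟨rfl, rfl⟩⟩)⟩
        · rw [if_neg h1]
          obtain ⟨hdis, -, -, hv, -, hc3, hsub1, hsub2⟩ := hKc q hq h1 h2v
          exact ⟨(hpos _ 0).2 ⟨hdis, (pc0 _).2 ⟨hv, hVW hv⟩⟩, ⟨hsub1, hsub2⟩, Or.inr (Or.inr ⟨rfl, Or.inl ⟨rfl, hc3⟩⟩)⟩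
  · rintro ⟨q, i⟩ ht ⟨q', i'⟩ ht' hΦ
    obtain ⟨hq, hn⟩ := (hneg q i).1 ht
    obtain ⟨hq', hn'⟩ := (hneg q' i').1 ht'
    -- the image of an `N3` token off `T₂` is a unit `a` at a configuration off `𝒲` in copy 3
    have h2img : ∀ p : Set ι × Set ι, Disjoint p.1 p.2 → cp₂ τ p ∈ 𝒱 → cp₃ τ p ∉ 𝒲 →
        ∃ p' : Set ι × Set ι, Φ (p, 2) = (p', 0) ∧ cp₃ τ p' ∉ 𝒲 ∧ cp₁ τ p' ∈ 𝒱 ∧ (cp₂ τ p' ∈ 𝒱 → p' = p) := by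
      intro p hp h2v h3
      rw [Φ2, if_neg h3]
      by_cases h1 : cp₁ τ p ∈ 𝒱
      · rw [if_pos h1]; exact ⟨p, rfl, h3, h1, fun _ => rfl⟩
      · rw [if_neg h1]
        obtain ⟨-, -, -, hv, h2, hc3, -⟩ := hKc p hp h1 h2v
        exact ⟨Kc p, rfl, by rw [hc3]; exact h3, hv, fun h2' => absurd h2' h2⟩
    fin_cases i <;> fin_cases i'
    · -- (0,0)
      simp only [Fin.zero_eta, Fin.isValue] at hΦ ⊢
      rw [Φ0, Φ0] at hΦ; exact hΦ
    · -- (0,1)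
      simp only [Fin.zero_eta, Fin.isValue, Fin.mk_one] at hΦ ⊢
      rw [Φ0, Φ1] at hΦ
      have e := congrArg Prod.snd hΦ
      split_ifs at e <;> simp at e
    · -- (0,2)
      simp only [Fin.zero_eta, Fin.isValue, Fin.reduceFinMk] at hn hn' hΦ ⊢
      obtain ⟨-, h3⟩ := (nc0 q).1 hn
      obtain ⟨h2v', -⟩ := (nc2 q').1 hn'
      rw [Φ0] at hΦ
      by_cases h3' : cp₃ τ q' ∈ 𝒲
      · rw [Φ2, if_pos h3'] at hΦ
        have e := congrArg Prod.snd hΦ; simp at e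
      · obtain ⟨p', hp', hp3, -, -⟩ := h2img q' hq' h2v' h3'
        rw [hp'] at hΦ
        have e : q = p' := congrArg Prod.fst hΦ
        rw [← e] at hp3
        exact absurd h3 hp3
    · -- (1,0)
      simp only [Fin.zero_eta, Fin.isValue, Fin.mk_one] at hΦ ⊢
      rw [Φ1, Φ0] at hΦ
      have e := congrArg Prod.snd hΦ
      split_ifs at e <;> simp at e
    · -- (1,1)
      simp only [Fin.mk_one, Fin.isValue] at hn hn' hΦ ⊢
      obtain ⟨h1w, h2v⟩ := (nc1 q).1 hn
      obtain ⟨h1w', h2v'⟩ := (nc1 q').1 hn'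
      rw [Φ1, Φ1] at hΦ
      by_cases h1 : cp₁ τ q ∈ 𝒱 <;> by_cases h1' : cp₁ τ q' ∈ 𝒱
      · rw [if_pos h1, if_pos h1'] at hΦ; exact hΦ
      · rw [if_pos h1, if_neg h1'] at hΦ
        have e : q = Cc q' := congrArg Prod.fst hΦ
        have hc := (hCc q' hq' h1w' h1' h2v').2.2.2.2.2.1
        rw [← e] at hc
        exact absurd h2v hc
      · rw [if_neg h1, if_pos h1'] at hΦ
        have e : Cc q = q' := congrArg Prod.fst hΦ
        have hc := (hCc q hq h1w h1 h2v).2.2.2.2.2.1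
        rw [e] at hc
        exact absurd h2v' hc
      · rw [if_neg h1, if_neg h1'] at hΦ
        have e : Cc q = Cc q' := congrArg Prod.fst hΦ
        obtain ⟨-, hun, hc1, -⟩ := hCc q hq h1w h1 h2v
        obtain ⟨-, hun', hc1', -⟩ := hCc q' hq' h1w' h1' h2v'
        have hU : q.1 ∪ q.2 = q'.1 ∪ q'.2 := by rw [← hun, e, hun']
        have hhh : h (q.1 ∪ q.2) (cp₁ τ q) = h (q.1 ∪ q.2) (cp₁ τ q') := by rw [← hc1, e, hc1', hU]
        have memT : ∀ p : Set ι × Set ι, Disjoint p.1 p.2 → cp₁ τ p ∈ 𝒲 → cp₁ τ p ∉ 𝒱 → cp₂ τ p ∈ 𝒱 →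
            cp₁ τ p ∈ {a : Set ι | a \ (p.1 ∪ p.2) = τ \ (p.1 ∪ p.2) ∧ a ∈ 𝒲 ∧ a ∉ 𝒱 ∧ a ∆ (p.1 ∪ p.2) ∈ 𝒱} := by
          intro p hp hw hv h2
          exact ⟨cp₁_sdiff_union τ p, hw, hv, by rw [← cp₂_eq_cp₁_symmDiff_union τ hp]; exact h2⟩
        have h11 : cp₁ τ q = cp₁ τ q' := by
          have hq'T := memT q' hq' h1w' h1' h2v'
          rw [← hU] at hq'T
          exact (hh (q.1 ∪ q.2)).1 (memT q hq h1w h1 h2v) hq'T hhh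
        have hfst : q.1 = q'.1 := by
          have e1 := congrArg (fun s => s ∆ τ) h11
          simpa only [cp₁, symmDiff_symmDiff_cancel_right] using e1
        have hsnd : q.2 = q'.2 := by
          rw [snd_eq_union_sdiff_fst hq, snd_eq_union_sdiff_fst hq', hU, hfst]
        have hqq : q = q' := Prod.ext hfst hsnd
        rw [hqq]
    · -- (1,2)
      simp only [Fin.mk_one, Fin.isValue, Fin.reduceFinMk] at hn' hΦ ⊢
      obtain ⟨h2v', -⟩ := (nc2 q').1 hn'
      have e := congrArg Prod.snd hΦ
      rw [Φ1] at e
      by_cases h3' : cp₃ τ q' ∈ 𝒲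
      · rw [Φ2, if_pos h3'] at e
        split_ifs at e <;> simp at e
      · obtain ⟨p', hp', -, -, -⟩ := h2img q' hq' h2v' h3'
        rw [hp'] at e
        split_ifs at e <;> simp at e
    · -- (2,0)
      simp only [Fin.zero_eta, Fin.isValue, Fin.reduceFinMk] at hn hn' hΦ ⊢
      obtain ⟨-, h3'⟩ := (nc0 q').1 hn'
      obtain ⟨h2v, -⟩ := (nc2 q).1 hn
      rw [Φ0] at hΦ
      by_cases h3 : cp₃ τ q ∈ 𝒲
      · rw [Φ2, if_pos h3] at hΦ
        have e := congrArg Prod.snd hΦ; simp at e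
      · obtain ⟨p, hp, hp3, -, -⟩ := h2img q hq h2v h3
        rw [hp] at hΦ
        have e : p = q' := congrArg Prod.fst hΦ
        rw [e] at hp3
        exact absurd h3' hp3
    · -- (2,1)
      simp only [Fin.mk_one, Fin.isValue, Fin.reduceFinMk] at hn hΦ ⊢
      obtain ⟨h2v, -⟩ := (nc2 q).1 hn
      have e := congrArg Prod.snd hΦ
      rw [Φ1] at e
      by_cases h3 : cp₃ τ q ∈ 𝒲
      · rw [Φ2, if_pos h3] at e
        split_ifs at e <;> simp at e
      · obtain ⟨p, hp, -, -, -⟩ := h2img q hq h2v h3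
        rw [hp] at e
        split_ifs at e <;> simp at e
    · -- (2,2)
      simp only [Fin.reduceFinMk, Fin.isValue] at hn hn' hΦ ⊢
      obtain ⟨h2v, -⟩ := (nc2 q).1 hn
      obtain ⟨h2v', -⟩ := (nc2 q').1 hn'
      by_cases h3 : cp₃ τ q ∈ 𝒲 <;> by_cases h3' : cp₃ τ q' ∈ 𝒲
      · rw [Φ2, Φ2, if_pos h3, if_pos h3'] at hΦ; exact hΦ
      · obtain ⟨p', hp', -, -, -⟩ := h2img q' hq' h2v' h3'
        rw [Φ2, if_pos h3, hp'] at hΦ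
        have e := congrArg Prod.snd hΦ; simp at e
      · obtain ⟨p, hp, -, -, -⟩ := h2img q hq h2v h3
        rw [hp, Φ2, if_pos h3'] at hΦ
        have e := congrArg Prod.snd hΦ; simp at e
      · rw [Φ2, Φ2, if_neg h3, if_neg h3'] at hΦ
        by_cases h1 : cp₁ τ q ∈ 𝒱 <;> by_cases h1' : cp₁ τ q' ∈ 𝒱
        · rw [if_pos h1, if_pos h1'] at hΦ
          have e : q = q' := congrArg Prod.fst hΦ
          rw [e]
        · rw [if_pos h1, if_neg h1'] at hΦ
          have e : q = Kc q' := congrArg Prod.fst hΦ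
          have hc := (hKc q' hq' h1' h2v').2.2.2.2.1
          rw [← e] at hc
          exact absurd h2v hc
        · rw [if_neg h1, if_pos h1'] at hΦ
          have e : Kc q = q' := congrArg Prod.fst hΦ
          have hc := (hKc q hq h1 h2v).2.2.2.2.1
          rw [e] at hc
          exact absurd h2v' hc
        · rw [if_neg h1, if_neg h1'] at hΦ
          have e : Kc q = Kc q' := congrArg Prod.fst hΦ
          obtain ⟨-, hun, hc1, -⟩ := hKc q hq h1 h2v
          obtain ⟨-, hun', hc1', -⟩ := hKc q' hq' h1' h2v'
          have hU : q.1 ∪ q.2 = q'.1 ∪ q'.2 := by rw [← hun, e, hun']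
          have hgg : g (q.1 ∪ q.2) (cp₁ τ q) = g (q.1 ∪ q.2) (cp₁ τ q') := by rw [← hc1, e, hc1', hU]
          have h11 : cp₁ τ q = cp₁ τ q' := by
            have hq'T := memBad q' hq' h1' h2v'
            rw [← hU] at hq'T
            exact (hg (q.1 ∪ q.2)).1.injOn (memBad q hq h1 h2v) hq'T hgg
          have hfst : q.1 = q'.1 := by
            have e1 := congrArg (fun s => s ∆ τ) h11
            simpa only [cp₁, symmDiff_symmDiff_cancel_right] using e1
          have hsnd : q.2 = q'.2 := by
            rw [snd_eq_union_sdiff_fst hq, snd_eq_union_sdiff_fst hq', hU, hfst]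
          have hqq : q = q' := Prod.ext hfst hsnd
          rw [hqq]

/-- Hence `GTMatchable τ 𝒱 𝒲` for `𝒱 ⊆ 𝒲` by an explicit typed matching (the sum-level statement is `gtMatchable_of_nested`). [this work] -/
theorem gtMatchable_of_subset (τ : Set ι) {𝒱 𝒲 : Set (Set ι)} (h𝒱 : IsUpperSet 𝒱) (h𝒲 : IsUpperSet 𝒲) (hVW : 𝒱 ⊆ 𝒲) :
    GTMatchable τ 𝒱 𝒲 :=
  gtMatchable_of_typedMatchable (typedMatchable_of_subset τ h𝒱 h𝒲 hVW)

end Summit.CriticalPhenomena.PercolationContinuityZ3.Theorems.ThreePartition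

end
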